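import Summits.AtomisticToContinuum.FouriersLaw.Theorems.AbelRegularity.Negative.LacunaryPulse
import HarnessLib

/-!
# `AbelRegularity` / Negative: a time-domain memory with all the "basics" whose Abel means oscillate

Support file (`--supports stmt-AtomisticToContinuum-15384`) of the crux disprover (cdisprove) of the crux
`CoercivePulse.AbelRegularity` (stmt-AtomisticToContinuum-15384; shared verbatim with `HoelderEscapeProfile.AbelRegularity`):
"for a guarded `(μ_T, D)` of the pinned anharmonic chain the Abel means `A(ν) = ∫₀^∞ e^{-νt} C_T(t) dt` of the summed
current autocorrelation converge in `ℝ` or tend to `+∞` as `ν ↓ 0`".  The crux is NOT refuted here: by dynamics rigidity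
(`HeatVarianceCalculus.CanonicalRigidity.flow_ae_eq_canonical`) and uniqueness of the shift-invariant DLR state every guarded
pair is the canonical one, so the crux is the (open) zero-frequency regularity of THE current spectral measure of the chain.

What this file lands, importably, is the TIME-DOMAIN form of the crux's recorded failure mode ("lacunary spectral mass at
`ω = 0`" / "endless alternation of persistent and anti-persistent epochs on geometrically growing time scales", the
`Why it might fail` of the picked line's physics stub S5), matched to the signatures of the picked line `Sketch`
(`Cruxes/AbelRegularity/Lines/Sketch.lean`):

* `exists_memory_abelMeans_oscillate` — an explicit continuous, even, bounded memory `F` (the LACUNARY PULSE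
  `F(t) = Σₖ ρᵏ(e^{-ρᵏ|t|} − 2⁻⁸ e^{-ρᵏ|t|/256})`, `ρ = 2⁻¹⁶`) with `|F| ≤ F(0)`, `F(0) > 0`, `F(t) → 0` at `+∞`,
  Laplace-integrable with NON-NEGATIVE Abel means, whose Abel means oscillate: `A(ρⁿ/16) ≥ 15/17` and `A(ρⁿ/4096) ≤ (1/8)(1−ρ)⁻¹` (the calculus is Part 1,
  `Negative/LacunaryPulse.lean`: the Abel means are the lacunary series `Σₖ [ρᵏ/(ν+ρᵏ) − (ρᵏ/256)/(ν+ρᵏ/256)]` of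
  non-negative bumps in `log ν`);
* `not_abelDichotomy_of_basics` — the NATURAL STRENGTHENING "every continuous memory with `|C| ≤ C(0)`, Laplace-integrable,
  with `A ≥ 0`, has the Abel dichotomy" is FALSE; these hypotheses are exactly the output of the line's tree-glue stub S1
  (`stub_currentCorrelationBasics`, landed), i.e. everything the line extracts from the chain apart from its physics stub
  S5 (`stub_tameFilteredMemory`): the composition `AbelRegularity_of` genuinely hinges on S5 (time-domain twin of
  `Negative.not_poissonMeans_dichotomy`, p150651, which needed the unproved Stieltjes representation to speak about the line);
* `not_abelDichotomy_of_tendsto_zero` — stub S3's hypothesis `F⁻ ∈ L¹(0,∞)` (`stub_abelOfIntegrableNegPart`, landed) cannot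
  be weakened to decay `F(t) → 0` (the pulse decays like `1/t`; its anticorrelation has infinite area);
* `filterTransfer_false_without_mass` — the mass condition `0 < ∫ψ` of stub S2 (iv) is load-bearing (`ψ ≡ 0`);
* `monotoneAbelOfSignedMoment_false_without_lowerBound` — the lower bound `b ≤ A` of stub S4 is load-bearing in
  its `W_k ≤ 0` branch (`F ≡ −1`: `W_0 = −t²/2 ≤ 0`, `A = −1/ν → −∞`).

For the provers: by the fully proved composition `AbelRegularity_of` and the truth of S2–S4, the lacunary pulse is a
TEST MEMORY on which S5's conclusion must fail for every causal filter `ψ` — every `W_k[F^ψ]` changes sign unboundedly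
often and `(F^ψ)⁻ ∉ L¹`; a proof of S5 has to exclude exactly this profile for the chain's `C_T`.  Discrete prototype of
the oscillation: Hardy 1907, `lim_{x→1⁻} Σ(−1)ᵏx^{2ᵏ}` does not exist (Montgomery–Vaughan 2007, Exercise 5.2.30).
No new definitions (the pulse is written out in each signature).  Refuter seat
refuter-cdisprove-stmt-AtomisticToContinuum-15384-0, 2026-08-17.
-/

noncomputable section

namespace Summit.AtomisticToContinuum.FouriersLaw.Theorems.AbelRegularity.Negative

open MeasureTheory Set Filter Topology

/-! ## §1 The witness theorem and the refuted strengthenings -/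

/-- **A time-domain memory with every "basic" property whose Abel means oscillate.** There is a continuous,
even, bounded function `F : ℝ → ℝ` with `|F| ≤ F(0)`, `F(0) > 0`, `F(t) → 0` as `t → +∞`, Laplace-integrable on
`(0,∞)` for every `ν > 0` with NON-NEGATIVE Abel means `A(ν) = ∫₀^∞ e^{-νt}F(t)dt ≥ 0`, whose Abel means neither
converge in `ℝ` nor tend to `+∞` as `ν ↓ 0`: the lacunary pulse `F(t) = Σₖ ρᵏ(e^{-ρᵏ|t|} − 2⁻⁸e^{-ρᵏ|t|/256})`,
`ρ = 2⁻¹⁶` — an endless alternation of persistent (`g > 0` up to time `≈ 5.6·ρ⁻ᵏ`) and anti-persistent epochs on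
geometrically separated time scales, each of zero area; `A(ρⁿ/16) ≥ 15/17`, `A(ρⁿ/4096) ≤ (1/8)(1−ρ)⁻¹`.
(`F` is moreover of positive type — each scale has spectral density `∝ ω²/((ρ²ᵏ+ω²)(ρ²ᵏ2⁻¹⁶+ω²)) ≥ 0` — i.e. an
honest stationary autocorrelation; that remark is not used or proved here.)  Time-domain twin of
`exists_isFiniteMeasure_poissonMeans_oscillate`; discrete prototype: Hardy 1907, `Σ(−1)ᵏx^{2ᵏ}` has no limit at
`1⁻` (Montgomery–Vaughan 2007, Exercise 5.2.30). [folklore] -/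
theorem exists_memory_abelMeans_oscillate :
    ∃ F : ℝ → ℝ, Continuous F ∧ (∀ t : ℝ, |F t| ≤ F 0) ∧ 0 < F 0 ∧ (∀ t : ℝ, F (-t) = F t) ∧
      Tendsto F atTop (𝓝 0) ∧
      (∀ ν : ℝ, 0 < ν → IntegrableOn (fun t : ℝ => Real.exp (-(ν * t)) * F t) (Ioi 0)) ∧
      (∀ ν : ℝ, 0 < ν → 0 ≤ ∫ t in Ioi (0:ℝ), Real.exp (-(ν * t)) * F t) ∧
      ¬ ((∃ L : ℝ, Tendsto (fun ν : ℝ => ∫ t in Ioi (0:ℝ), Real.exp (-(ν * t)) * F t) (𝓝[>] 0) (𝓝 L)) ∨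
          Tendsto (fun ν : ℝ => ∫ t in Ioi (0:ℝ), Real.exp (-(ν * t)) * F t) (𝓝[>] 0) atTop) := by
  refine ⟨fun t : ℝ => ∑' k : ℕ, (1 / 65536 : ℝ) ^ k * (Real.exp (-((1 / 65536 : ℝ) ^ k * |t|)) -
      1 / 256 * Real.exp (-((1 / 65536 : ℝ) ^ k / 256 * |t|))),
    continuous_lacunaryPulse, abs_lacunaryPulse_le, lacunaryPulse_zero_pos, fun t => by simp only [abs_neg],
    tendsto_lacunaryPulse_atTop, fun ν hν => integrableOn_exp_neg_mul_lacunaryPulse hν,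
    fun ν hν => abelMeans_lacunaryPulse_nonneg hν, ?_⟩
  have hlt : 1 / 8 * (1 - 1 / 65536 : ℝ)⁻¹ < 15 / 17 := by norm_num
  rintro (⟨L, hL⟩ | htop)
  · have hlo : (15 / 17 : ℝ) ≤ L :=
      ge_of_tendsto (hL.comp (tendsto_lacunaryScales_div 16 (by norm_num)))
        (Eventually.of_forall fun n => abelMeans_lacunaryPulse_ge n)
    have hhi : L ≤ 1 / 8 * (1 - 1 / 65536 : ℝ)⁻¹ :=
      le_of_tendsto (hL.comp (tendsto_lacunaryScales_div 4096 (by norm_num)))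
        (Eventually.of_forall fun n => abelMeans_lacunaryPulse_le n)
    linarith
  · obtain ⟨n, hn⟩ := ((htop.comp (tendsto_lacunaryScales_div 4096 (by norm_num))).eventually_ge_atTop 1).exists
    have := abelMeans_lacunaryPulse_le n
    have h1 : (1 : ℝ) ≤ 1 / 8 * (1 - 1 / 65536 : ℝ)⁻¹ := hn.trans this
    norm_num at h1

/-- **The basics of stub S1 do not give the crux.** It is NOT the case that every continuous memory `C` with
`|C| ≤ C(0)`, Laplace-integrable with non-negative Abel means — exactly the output of the line's tree-glue stub
`stub_currentCorrelationBasics`, i.e. everything the line `Sketch` extracts from the chain apart from its physics stub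
S5 — has the Abel dichotomy.  Hence the composition `AbelRegularity_of` genuinely hinges on `stub_tameFilteredMemory`,
and any proof of `AbelRegularity` must use zero-frequency information on THE chain beyond stationarity / positive type
(time-domain twin of `not_poissonMeans_dichotomy`). [folklore] -/
theorem not_abelDichotomy_of_basics :
    ¬ ∀ F : ℝ → ℝ, Continuous F → (∀ t : ℝ, |F t| ≤ F 0) →
      (∀ ν : ℝ, 0 < ν → IntegrableOn (fun t : ℝ => Real.exp (-(ν * t)) * F t) (Ioi 0)) →
      (∀ ν : ℝ, 0 < ν → 0 ≤ ∫ t in Ioi (0:ℝ), Real.exp (-(ν * t)) * F t) →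
      ((∃ L : ℝ, Tendsto (fun ν : ℝ => ∫ t in Ioi (0:ℝ), Real.exp (-(ν * t)) * F t) (𝓝[>] 0) (𝓝 L)) ∨
        Tendsto (fun ν : ℝ => ∫ t in Ioi (0:ℝ), Real.exp (-(ν * t)) * F t) (𝓝[>] 0) atTop) := by
  intro h
  obtain ⟨F, hc, hb, -, -, -, hi, hA, hnot⟩ := exists_memory_abelMeans_oscillate
  exact hnot (h F hc hb hi hA)

/-- **Stub S3's hypothesis `F⁻ ∈ L¹(0,∞)` cannot be weakened to decay of the memory.** It is NOT the case that
every continuous memory with `|F| ≤ F(0)`, `F(t) → 0` at `+∞` (so `F⁻ → 0`) and non-negative Abel means has the Abel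
dichotomy: the lacunary pulse decays but its anticorrelation has infinite total area (each scale has zero signed area
and unit-order unsigned area). [folklore] -/
theorem not_abelDichotomy_of_tendsto_zero :
    ¬ ∀ F : ℝ → ℝ, Continuous F → (∀ t : ℝ, |F t| ≤ F 0) → Tendsto F atTop (𝓝 0) →
      (∀ ν : ℝ, 0 < ν → 0 ≤ ∫ t in Ioi (0:ℝ), Real.exp (-(ν * t)) * F t) →
      ((∃ L : ℝ, Tendsto (fun ν : ℝ => ∫ t in Ioi (0:ℝ), Real.exp (-(ν * t)) * F t) (𝓝[>] 0) (𝓝 L)) ∨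
        Tendsto (fun ν : ℝ => ∫ t in Ioi (0:ℝ), Real.exp (-(ν * t)) * F t) (𝓝[>] 0) atTop) := by
  intro h
  obtain ⟨F, hc, hb, -, -, hz, -, hA, hnot⟩ := exists_memory_abelMeans_oscillate
  exact hnot (h F hc hb hz hA)


/-! ## §2 Load-bearing hypotheses of the line's analysis stubs S2 and S4 -/

/-- **The mass condition `0 < ∫ψ` of stub S2 (iv) (`stub_filterTransfer`) is load-bearing.** Without it the
transfer "`Dichotomy(F^ψ) ⇒ Dichotomy(F)`" fails: the zero filter `ψ ≡ 0` (`U = 0`) kills every memory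
(`F^ψ ≡ 0` has Abel means `≡ 0 → 0`) while the lacunary pulse `F` oscillates. [folklore] -/
theorem filterTransfer_false_without_mass :
    ¬ ∀ (F : ℝ → ℝ) (M : ℝ) (ψ : ℝ → ℝ) (U : ℝ), Continuous F → (∀ t : ℝ, |F t| ≤ M) → Continuous ψ →
      0 ≤ U → (∀ u : ℝ, 0 ≤ ψ u) →
      (((∃ L : ℝ, Tendsto (fun ν : ℝ => ∫ t in Ioi (0:ℝ), Real.exp (-(ν * t)) *
            ∫ u in Icc (0:ℝ) U, ψ u * F (t + u)) (𝓝[>] 0) (𝓝 L)) ∨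
          Tendsto (fun ν : ℝ => ∫ t in Ioi (0:ℝ), Real.exp (-(ν * t)) *
            ∫ u in Icc (0:ℝ) U, ψ u * F (t + u)) (𝓝[>] 0) atTop) →
        ((∃ L : ℝ, Tendsto (fun ν : ℝ => ∫ t in Ioi (0:ℝ), Real.exp (-(ν * t)) * F t) (𝓝[>] 0) (𝓝 L)) ∨
          Tendsto (fun ν : ℝ => ∫ t in Ioi (0:ℝ), Real.exp (-(ν * t)) * F t) (𝓝[>] 0) atTop)) := by
  intro h
  obtain ⟨F, hc, hb, -, -, -, -, -, hnot⟩ := exists_memory_abelMeans_oscillate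
  refine hnot (h F (F 0) (fun _ => 0) 0 hc hb continuous_const le_rfl (fun _ => le_rfl) (Or.inl ⟨0, ?_⟩))
  simp only [zero_mul, integral_zero, mul_zero]
  exact tendsto_const_nhds

/-- **The lower bound `b ≤ A(ν)` (`ν ∈ (0,1]`) of stub S4 (`stub_monotoneAbelOfSignedMoment`) is load-bearing.**
Without it the `W_k ≤ 0` branch fails: the constant memory `F ≡ -1` is continuous, `|F| ≤ 1`, has
`W_0(t) = ∫₀ᵗ s·(−1) ds = −t²/2 ≤ 0` for all `t`, and Abel means `−1/ν → −∞`, which neither converge nor tend to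
`+∞`. (In the line, `b` comes from `A[C] ≥ 0`, i.e. from `PreservesMeasure` through S1 and S2 (iii).) [folklore] -/
theorem monotoneAbelOfSignedMoment_false_without_lowerBound :
    ¬ ∀ (F : ℝ → ℝ) (M t₀ : ℝ) (k : ℕ), Continuous F → (∀ t : ℝ, |F t| ≤ M) →
      ((∀ t : ℝ, t₀ ≤ t → 0 ≤ ∫ s in (0:ℝ)..t, (t - s) ^ k * (s * F s)) ∨
        (∀ t : ℝ, t₀ ≤ t → ∫ s in (0:ℝ)..t, (t - s) ^ k * (s * F s) ≤ 0)) →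
      ((∃ L : ℝ, Tendsto (fun ν : ℝ => ∫ t in Ioi (0:ℝ), Real.exp (-(ν * t)) * F t) (𝓝[>] 0) (𝓝 L)) ∨
        Tendsto (fun ν : ℝ => ∫ t in Ioi (0:ℝ), Real.exp (-(ν * t)) * F t) (𝓝[>] 0) atTop) := by
  intro h
  have hW : ∀ t : ℝ, 0 ≤ t → ∫ s in (0:ℝ)..t, (t - s) ^ (0:ℕ) * (s * (fun _ : ℝ => (-1:ℝ)) s) ≤ 0 := by
    intro t _
    have e : (fun s : ℝ => (t - s) ^ (0:ℕ) * (s * (fun _ : ℝ => (-1:ℝ)) s)) = fun s => -s := funext fun s => by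
      simp
    rw [e, intervalIntegral.integral_neg, integral_id]
    nlinarith [sq_nonneg t]
  have hdich := h (fun _ => (-1:ℝ)) 1 0 0 continuous_const (fun t => by norm_num) (Or.inr hW)
  have hval : ∀ ν : ℝ, 0 < ν →
      ∫ t in Ioi (0:ℝ), Real.exp (-(ν * t)) * (fun _ : ℝ => (-1:ℝ)) t = -ν⁻¹ := fun ν hν => by
    have h1 : ∫ t in Ioi (0:ℝ), Real.exp (-(ν * t)) = ν⁻¹ := by
      rw [show (fun t : ℝ => Real.exp (-(ν * t))) = fun t => Real.exp (-ν * t) from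
        funext fun t => by rw [neg_mul], integral_exp_mul_Ioi (neg_lt_zero.mpr hν) 0, mul_zero,
        Real.exp_zero, neg_div, one_div, inv_neg, neg_neg]
    simp only [integral_mul_const, h1]
    ring
  have hbot : Tendsto (fun ν : ℝ => ∫ t in Ioi (0:ℝ), Real.exp (-(ν * t)) * (fun _ : ℝ => (-1:ℝ)) t)
      (𝓝[>] 0) atBot :=
    (tendsto_neg_atTop_atBot.comp tendsto_inv_nhdsGT_zero).congr'
      ((eventually_mem_nhdsWithin).mono fun ν hν => (hval ν hν).symm)
  rcases hdich with ⟨L, hL⟩ | htop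
  · exact not_tendsto_nhds_of_tendsto_atBot hbot L hL
  · exact hbot.not_tendsto disjoint_atBot_atTop htop

end Summit.AtomisticToContinuum.FouriersLaw.Theorems.AbelRegularity.Negative

end
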